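import Summits.NavierStokesRegularity.NavierStokesRegularity.Theorems.PoloidalWindowDoorPoloidalWindowRigidityZShockObliqueProfilePlane
import Summits.NavierStokesRegularity.NavierStokesRegularity.Theorems.PoloidalWindowDoorPoloidalWindowRigidityZShockMonotoneExtension
import HarnessLib

/-!
# Crux K2 `PoloidalWindowRigidity` (stmt-NavierStokesRegularity-19708), line `z_shock` — RANGE-LOCAL R2½, SUBSONIC REGIME: a bounds-preserving
# `C¹` extension off the compact value hull and the subsonic oblique-profile Liouville theorem with data on the hull only

`--supports stmt-NavierStokesRegularity-19708 --as helper` (leafhand-ns-poloidalwindowdoor-3 g8, cell decomp-ns, 2026-08-31).  Class-free,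
def-free, Mathlib + tree files only.  **No stub and no summit is closed by this file; Navier–Stokes regularity is NOT proved here (rung 0).**

Companion of `…ZShockRangeLocal` / `…ZShockRangeLocalAntitone` (supersonic regime, where genuine nonlinearity must be preserved by the extension).
In the SUBSONIC regime the tree's Liouville theorem `…ZShockObliqueProfilePlane.obliqueProfile_const_of_subsonic_plane` (De Giorgi–Nash–Moser via
the tree's `divFormLiouville_holds`) needs no sign of `γ'`, but still a GLOBAL `C¹` squared speed with global two-sided bounds `κ₀² < γlo ≤ γ ≤ γhi`.
Here:

* `exists_contDiffOne_extension_near` — a `C¹`-on-`[A, B]` function (`HasDerivAt` with derivative continuous on `[A, B]`, `|κ'| ≤ S` there)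
  extends, for every `δ > 0`, to a global `κ̃` with `κ̃ = κ` on `[A, B]`, `HasDerivAt κ̃ (κ̃' v) v` everywhere, `κ̃'` continuous, `|κ̃'| ≤ S`,
  and `κ A − δ ≤ κ̃ v ≤ κ A + δ` for `v ≤ A`, `κ B − δ ≤ κ̃ v ≤ κ B + δ` for `v ≥ B` (density `κ'(clamp)·m_A·n_B`, the graft-free version of
  `…ZShockMonotoneExtension`);
* `obliqueProfile_const_of_subsonic_plane_rangeLocal` — ★ a bounded `C²` profile `Ψ : ℝ² → ℝ` with values in `[A, B]` solving
  `∂₀(γ(Ψ)∂₀Ψ) = ∂₁((κ₀² − γ(Ψ))∂₁Ψ)`, with `γ` differentiable on `[A, B]`, `γ'` continuous and bounded there, and `κ₀² < γlo ≤ γ ≤ γhi` ON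
  `[A, B]`, is constant.

[folklore] (elementary real analysis + the tree's Moser–Liouville theorem.)
-/

noncomputable section

namespace Summit.NavierStokesRegularity.NavierStokesRegularity.Theorems.PoloidalWindowDoorPoloidalWindowRigidityZShockRangeLocalSubsonic

-- the summit and its single sub-problem share the name (CONVENTIONS §1)
set_option linter.dupNamespace false

open Set Filter Topology Function intervalIntegral
open Summit.NavierStokesRegularity.NavierStokesRegularity.Theorems.PoloidalWindowDoorPoloidalWindowRigidityZShockScalarWaveLiouville
open Summit.NavierStokesRegularity.NavierStokesRegularity.Theorems.PoloidalWindowDoorPoloidalWindowRigidityZShockObliqueProfilePlane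

/-! ### A bounds-preserving `C¹` extension off a compact interval -/

/-- **`C¹` extension staying near the endpoint values.**  See the module docstring. [folklore] -/
theorem exists_contDiffOne_extension_near {κ κ' : ℝ → ℝ} {A B S δ : ℝ} (hAB : A ≤ B) (hδ : 0 < δ)
    (hκd : ∀ v ∈ Icc A B, HasDerivAt κ (κ' v) v) (hκ'c : ContinuousOn κ' (Icc A B))
    (hS : ∀ v ∈ Icc A B, |κ' v| ≤ S) :
    ∃ κe κe' : ℝ → ℝ, (∀ v ∈ Icc A B, κe v = κ v) ∧ (∀ v ∈ Icc A B, κe' v = κ' v) ∧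
      (∀ v, HasDerivAt κe (κe' v) v) ∧ Continuous κe' ∧ (∀ v, |κe' v| ≤ S) ∧
      (∀ v, v ≤ A → |κe v - κ A| ≤ δ) ∧ (∀ v, B ≤ v → |κe v - κ B| ≤ δ) := by
  have hA : A ∈ Icc A B := ⟨le_rfl, hAB⟩
  have hB : B ∈ Icc A B := ⟨hAB, le_rfl⟩
  have hS0 : 0 ≤ S := (abs_nonneg _).trans (hS A hA)
  -- the small parameter
  set ε : ℝ := δ / (S + 1) with hε_def
  have hS1 : 0 < S + 1 := by linarith
  have hε0 : 0 < ε := div_pos hδ hS1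
  have hεδ : S * ε ≤ δ := by
    have h2 : (S + 1) * ε = δ := by rw [hε_def]; field_simp
    nlinarith
  -- the decaying weights
  set mA : ℝ → ℝ := fun t => Real.exp (min (t - A) 0 / ε) with hmA_def
  set nB : ℝ → ℝ := fun t => Real.exp (min (B - t) 0 / ε) with hnB_def
  have hmAc : Continuous mA := Real.continuous_exp.comp (((continuous_id.sub continuous_const).min continuous_const).div_const ε)
  have hnBc : Continuous nB := Real.continuous_exp.comp (((continuous_const.sub continuous_id).min continuous_const).div_const ε)
  have hmA_pos : ∀ t, 0 < mA t := fun t => Real.exp_pos _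
  have hnB_pos : ∀ t, 0 < nB t := fun t => Real.exp_pos _
  have hmA_le : ∀ t, mA t ≤ 1 := fun t =>
    Real.exp_le_one_iff.2 (div_nonpos_iff.2 (Or.inr ⟨min_le_right _ _, hε0.le⟩))
  have hnB_le : ∀ t, nB t ≤ 1 := fun t =>
    Real.exp_le_one_iff.2 (div_nonpos_iff.2 (Or.inr ⟨min_le_right _ _, hε0.le⟩))
  have hmA_one : ∀ t, A ≤ t → mA t = 1 := by
    intro t ht
    simp only [hmA_def, min_eq_right (sub_nonneg.2 ht), zero_div, Real.exp_zero]
  have hnB_one : ∀ t, t ≤ B → nB t = 1 := by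
    intro t ht
    simp only [hnB_def, min_eq_right (sub_nonneg.2 ht), zero_div, Real.exp_zero]
  have hmA_left : ∀ t, t ≤ A → mA t = Real.exp ((t - A) / ε) := by
    intro t ht
    simp only [hmA_def, min_eq_left (sub_nonpos.2 ht)]
  have hnB_right : ∀ t, B ≤ t → nB t = Real.exp ((B - t) / ε) := by
    intro t ht
    simp only [hnB_def, min_eq_left (sub_nonpos.2 ht)]
  -- the clamp and the clamped derivative
  set cl : ℝ → ℝ := fun t => max A (min B t) with hcl_def
  have hclc : Continuous cl := continuous_const.max (continuous_const.min continuous_id)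
  have hcl_mem : ∀ t, cl t ∈ Icc A B := fun t => ⟨le_max_left _ _, max_le hAB (min_le_left _ _)⟩
  have hcl_id : ∀ t ∈ Icc A B, cl t = t := by
    intro t ht
    simp only [hcl_def, min_eq_right ht.2, max_eq_right ht.1]
  have hcl_left : ∀ t, t ≤ A → cl t = A := fun t ht => max_eq_left ((min_le_right B t).trans ht)
  have hcl_right : ∀ t, B ≤ t → cl t = B := by
    intro t ht
    simp only [hcl_def, min_eq_left ht, max_eq_right hAB]
  set e : ℝ → ℝ := fun t => κ' (cl t) with he_def
  have hec : Continuous e := hκ'c.comp_continuous hclc hcl_mem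
  have heS : ∀ t, |e t| ≤ S := fun t => hS _ (hcl_mem t)
  -- the density and the extension
  set g : ℝ → ℝ := fun t => e t * (mA t * nB t) with hg_def
  have hgc : Continuous g := hec.mul (hmAc.mul hnBc)
  have hg_on : ∀ t ∈ Icc A B, g t = κ' t := by
    intro t ht
    simp only [hg_def, he_def, hmA_one t ht.1, hnB_one t ht.2, hcl_id t ht]
    ring
  have hmn : ∀ t, 0 ≤ mA t * nB t ∧ mA t * nB t ≤ 1 := fun t =>
    ⟨mul_nonneg (hmA_pos t).le (hnB_pos t).le, mul_le_one₀ (hmA_le t) (hnB_pos t).le (hnB_le t)⟩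
  have hgS : ∀ t, |g t| ≤ S := by
    intro t
    simp only [hg_def]
    rw [abs_mul, abs_of_nonneg (hmn t).1]
    calc |e t| * (mA t * nB t) ≤ S * 1 := by gcongr; exacts [heS t, (hmn t).2]
      _ = S := mul_one S
  have hg_left : ∀ t, t ≤ A → |g t| ≤ S * Real.exp ((t - A) / ε) := by
    intro t ht
    simp only [hg_def]
    rw [hmA_left t ht, hnB_one t (ht.trans hAB), mul_one, abs_mul, abs_of_nonneg (Real.exp_pos _).le]
    gcongr
    exact heS t
  have hg_right : ∀ t, B ≤ t → |g t| ≤ S * Real.exp ((B - t) / ε) := by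
    intro t ht
    simp only [hg_def]
    rw [hnB_right t ht, hmA_one t (hAB.trans ht), one_mul, abs_mul, abs_of_nonneg (Real.exp_pos _).le]
    gcongr
    exact heS t
  set κe : ℝ → ℝ := fun v => κ A + ∫ t in A..v, g t with hκe_def
  have hκed : ∀ v, HasDerivAt κe (g v) v := fun v =>
    ((hgc.integral_hasStrictDerivAt A v).hasDerivAt).const_add (κ A)
  have hκe_on : ∀ v ∈ Icc A B, κe v = κ v := by
    intro v hv
    have hsub : uIcc A v ⊆ Icc A B := by
      rw [uIcc_of_le hv.1]; exact Icc_subset_Icc le_rfl hv.2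
    have h1 : ∫ t in A..v, g t = ∫ t in A..v, κ' t := integral_congr fun t ht => hg_on t (hsub ht)
    have h2 : ∫ t in A..v, κ' t = κ v - κ A :=
      integral_eq_sub_of_hasDerivAt (fun t ht => hκd t (hsub ht)) ((hκ'c.mono hsub).intervalIntegrable)
    simp only [hκe_def, h1, h2]
    ring
  have hκe_FTC : ∀ a b : ℝ, ∫ t in a..b, g t = κe b - κe a := fun a b =>
    integral_eq_sub_of_hasDerivAt (fun t _ => hκed t) (hgc.intervalIntegrable a b)
  refine ⟨κe, g, hκe_on, hg_on, hκed, hgc, hgS, ?_, ?_⟩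
  · -- left tail
    intro v hv
    have hcont : Continuous fun t => S * Real.exp ((t - A) / ε) :=
      continuous_const.mul (Real.continuous_exp.comp ((continuous_id.sub continuous_const).div_const ε))
    have h1 : |∫ t in v..A, g t| ≤ ∫ t in v..A, S * Real.exp ((t - A) / ε) := by
      refine (intervalIntegral.abs_integral_le_integral_abs hv).trans ?_
      exact integral_mono_on hv (hgc.abs.intervalIntegrable v A) (hcont.intervalIntegrable v A) fun t ht => hg_left t ht.2
    have h2 : ∫ t in v..A, S * Real.exp ((t - A) / ε) = S * (ε * (1 - Real.exp ((v - A) / ε))) := by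
      rw [intervalIntegral.integral_const_mul,
        Summit.NavierStokesRegularity.NavierStokesRegularity.Theorems.PoloidalWindowDoorPoloidalWindowRigidityZShockMonotoneExtension.integral_exp_left_tail
          hε0]
    have h3 : S * (ε * (1 - Real.exp ((v - A) / ε))) ≤ S * ε := by
      have hx : 0 < Real.exp ((v - A) / ε) := Real.exp_pos _
      have hprod : 0 ≤ S * ε * Real.exp ((v - A) / ε) := mul_nonneg (mul_nonneg hS0 hε0.le) hx.le
      calc S * (ε * (1 - Real.exp ((v - A) / ε))) = S * ε - S * ε * Real.exp ((v - A) / ε) := by ring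
        _ ≤ S * ε := by linarith
    have h4 : ∫ t in v..A, g t = κe A - κe v := hκe_FTC v A
    have h5 : κe A = κ A := hκe_on A hA
    rw [show κe v - κ A = -(∫ t in v..A, g t) by rw [h4, h5]; ring, abs_neg]
    linarith
  · -- right tail
    intro v hv
    have hcont : Continuous fun t => S * Real.exp ((B - t) / ε) :=
      continuous_const.mul (Real.continuous_exp.comp ((continuous_const.sub continuous_id).div_const ε))
    have h1 : |∫ t in B..v, g t| ≤ ∫ t in B..v, S * Real.exp ((B - t) / ε) := by
      refine (intervalIntegral.abs_integral_le_integral_abs hv).trans ?_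
      exact integral_mono_on hv (hgc.abs.intervalIntegrable B v) (hcont.intervalIntegrable B v) fun t ht => hg_right t ht.1
    have h2 : ∫ t in B..v, S * Real.exp ((B - t) / ε) = S * (ε * (1 - Real.exp ((B - v) / ε))) := by
      rw [intervalIntegral.integral_const_mul,
        Summit.NavierStokesRegularity.NavierStokesRegularity.Theorems.PoloidalWindowDoorPoloidalWindowRigidityZShockMonotoneExtension.integral_exp_right_tail
          hε0]
    have h3 : S * (ε * (1 - Real.exp ((B - v) / ε))) ≤ S * ε := by
      have hx : 0 < Real.exp ((B - v) / ε) := Real.exp_pos _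
      have hprod : 0 ≤ S * ε * Real.exp ((B - v) / ε) := mul_nonneg (mul_nonneg hS0 hε0.le) hx.le
      calc S * (ε * (1 - Real.exp ((B - v) / ε))) = S * ε - S * ε * Real.exp ((B - v) / ε) := by ring
        _ ≤ S * ε := by linarith
    have h4 : ∫ t in B..v, g t = κe v - κe B := hκe_FTC B v
    have h5 : κe B = κ B := hκe_on B hB
    rw [show κe v - κ B = ∫ t in B..v, g t by rw [h4, h5]]
    linarith

/-! ### Range-local subsonic oblique profiles -/

/-- ★ **R2½ RANGE-LOCAL, subsonic regime.**  `Ψ : ℝ² → ℝ` of class `C²`, values in `[A, B]`, solving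
`∂₀(γ(Ψ)∂₀Ψ) = ∂₁((κ₀² − γ(Ψ))∂₁Ψ)`; `γ` differentiable at every point of `[A, B]` with derivative `γ'` continuous and `|γ'| ≤ g₁` there,
`κ₀² < γlo ≤ γ ≤ γhi` ON `[A, B]`.  Then `Ψ` is constant.  Proof: extend `γ` by `exists_contDiffOne_extension_near` with `δ = (γlo − κ₀²)/2`
(the extension stays uniformly subsonic, `γ̃ ≥ (γlo + κ₀²)/2 > κ₀²`, and bounded by `γhi + δ`), and apply the tree's
`obliqueProfile_const_of_subsonic_plane`. [folklore] -/
theorem obliqueProfile_const_of_subsonic_plane_rangeLocal {Ψ : EuclideanSpace ℝ (Fin 2) → ℝ} {γ γ' : ℝ → ℝ}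
    {A B κ₀ γlo γhi g₁ : ℝ} (hΨ : ContDiff ℝ 2 Ψ) (hrange : ∀ y, Ψ y ∈ Icc A B)
    (hγd : ∀ r ∈ Icc A B, HasDerivAt γ (γ' r) r) (hγ'c : ContinuousOn γ' (Icc A B)) (hg₁ : ∀ r ∈ Icc A B, |γ' r| ≤ g₁)
    (hpde : ∀ y : EuclideanSpace ℝ (Fin 2),
      fderiv ℝ (fun y' => γ (Ψ y') * fderiv ℝ Ψ y' (EuclideanSpace.single 0 1)) y (EuclideanSpace.single 0 1) =
        fderiv ℝ (fun y' => (κ₀ ^ 2 - γ (Ψ y')) * fderiv ℝ Ψ y' (EuclideanSpace.single 1 1)) y (EuclideanSpace.single 1 1))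
    (hsub : κ₀ ^ 2 < γlo) (hγlo : ∀ r ∈ Icc A B, γlo ≤ γ r) (hγhi : ∀ r ∈ Icc A B, γ r ≤ γhi) :
    ∀ y y' : EuclideanSpace ℝ (Fin 2), Ψ y = Ψ y' := by
  have hAB : A ≤ B := (hrange 0).1.trans (hrange 0).2
  have hA : A ∈ Icc A B := ⟨le_rfl, hAB⟩
  have hB : B ∈ Icc A B := ⟨hAB, le_rfl⟩
  set δ : ℝ := (γlo - κ₀ ^ 2) / 2 with hδ_def
  have hδ : 0 < δ := by rw [hδ_def]; linarith
  obtain ⟨γe, γe', hγe_on, -, hγed, hγe'c, -, hleft, hright⟩ :=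
    exists_contDiffOne_extension_near hAB hδ hγd hγ'c hg₁
  have hγe1 : ContDiff ℝ 1 γe := contDiff_one_of_hasDerivAt hγed hγe'c
  -- global two-sided bounds of the extension
  have hbounds : ∀ r, γlo - δ ≤ γe r ∧ γe r ≤ γhi + δ := by
    intro r
    rcases le_total r A with h | h
    · have h1 := abs_le.1 (hleft r h)
      exact ⟨by linarith [hγlo A hA, h1.1], by linarith [hγhi A hA, h1.2]⟩
    · rcases le_total r B with h' | h'
      · have hr : r ∈ Icc A B := ⟨h, h'⟩
        rw [hγe_on r hr]
        exact ⟨by linarith [hγlo r hr], by linarith [hγhi r hr]⟩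
      · have h1 := abs_le.1 (hright r h')
        exact ⟨by linarith [hγlo B hB, h1.1], by linarith [hγhi B hB, h1.2]⟩
  have hfun1 : (fun y' => γe (Ψ y') * fderiv ℝ Ψ y' (EuclideanSpace.single 0 1)) =
      fun y' => γ (Ψ y') * fderiv ℝ Ψ y' (EuclideanSpace.single 0 1) :=
    funext fun y' => by rw [hγe_on _ (hrange y')]
  have hfun2 : (fun y' => (κ₀ ^ 2 - γe (Ψ y')) * fderiv ℝ Ψ y' (EuclideanSpace.single 1 1)) =
      fun y' => (κ₀ ^ 2 - γ (Ψ y')) * fderiv ℝ Ψ y' (EuclideanSpace.single 1 1) :=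
    funext fun y' => by rw [hγe_on _ (hrange y')]
  have hpde' : ∀ y : EuclideanSpace ℝ (Fin 2),
      fderiv ℝ (fun y' => γe (Ψ y') * fderiv ℝ Ψ y' (EuclideanSpace.single 0 1)) y (EuclideanSpace.single 0 1) =
        fderiv ℝ (fun y' => (κ₀ ^ 2 - γe (Ψ y')) * fderiv ℝ Ψ y' (EuclideanSpace.single 1 1)) y (EuclideanSpace.single 1 1) :=
    fun y => by rw [hfun1, hfun2]; exact hpde y
  exact obliqueProfile_const_of_subsonic_plane (γ := γe) (γlo := γlo - δ) (γhi := γhi + δ) (MΨ := max |A| |B|) hΨ hγe1 hpde'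
    (by rw [hδ_def]; linarith) (fun r => (hbounds r).1) (fun r => (hbounds r).2)
    (fun y => abs_le_max_abs_abs (hrange y).1 (hrange y).2)

end Summit.NavierStokesRegularity.NavierStokesRegularity.Theorems.PoloidalWindowDoorPoloidalWindowRigidityZShockRangeLocalSubsonic

end
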